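import Mathlib
import HarnessLib
import Summits.HubbardSuperconductivity.HubbardSuperconductivity.Theorems.KLProgrammeKLRegimeEngineTowerBookkeepingProfile
import Summits.HubbardSuperconductivity.HubbardSuperconductivity.Theorems.KLProgrammeKLRegimeEngineTowerLevNumericsG

/-!
# Route `KLProgramme` — crux K3 ENGINE (stmt-HubbardSuperconductivity-20437 `KLRegimeEngineV17F2`), stub (b) v2, THE LEVELS PACKAGE (ℓ):
# the blocked-tower bookkeeping, part 9‴ — THE TRACK INDUCTION WITH ITS NUMERICS CLOSED, ARRAY- AND UNIT-FREE
# (cell gate-hubbard-kl, seat hubbard-kl-k3c3-p2 g14, «(I5)-LEV re-key» (R275)(A)(3); composition of `towerBorn_le_law_tracks_of_profile` (T3-P, p4 g18) with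
#  `towerLevNumericsG_rows` / `towerLevNumericsG_side_of_lam_le` (…TowerLevNumericsG); E1's (I5)/(I7) by the substitute precedent)

WHY.  The model-side assemblies of the levelled law (`klTowerBLev_le_law_of_inputs[_scaled/_uv]`, their `_disc` twins, and the floor-keyed / re-based twins of
located-risk #10 «(ℓ)-LEV-ODD» cure (ε) and «(ℓ)-BLOCK0-LOGM» cure (A″)) differ ONLY in which rows discharge T3-P's profile hypotheses (`hprof`, `hprof3`) and in the
constants of those rows; the kit and the (I5) numerics are array- and unit-free.  This file closes the numerics ONCE at that level: T3-P for abstract arrays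
`b : T → ℕ → ℕ → ℝ`, `μ : ℕ → ℕ → ℝ`, with the profile hypotheses in the PARAMETRIC ROW SHAPE every model scheme delivers —

  base / UV block:   `μ 0 m ≤ a₁·λ^{m−1}·q₀^m` (`3 ≤ m ≤ D`; `a₁ > 0`, `q₀ ≥ 0` = the base datum in its own, already B-discounted constants),
  blocks `k ≥ 1`:    given the law on the blocks `≤ k`, `μ k m ≤ κ_A·(a₂ + A/(1−r))·λ^{m−1}·(Z·κ_Q·max Q Q_b)^m` (`4 ≤ m ≤ D`) and
                     `μ k 3 ≤ max (W·Z³·X·λ²) (κ_A·(a₂ + A/(1−r))·λ²·(Z·κ_Q·max Q Q_b)³)` (the re-measurement `R`-rows with the base part `(a₂, Q_b)` and the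
                     six-leg cell `X`; `κ_A > 0`, `κ_Q ≥ 0`, `r < 1` the scheme's re-measurement constants — half-keyed: `W27⁵(C₁/C₂)8^{d−1}`, `C₂²2^{1−d}`, `(√2^d)⁻¹`),

the imports `μ k 1 ≤ ι₁λ`, `μ k 2 ≤ ι₂λ`, the step `hstep` (kit literal), and — instead of T3-P's five floors and eight numerics — the explicit (I5)-LEV-G choices
(equational binders) with the BLOCKING row `max 1 Z·κ_Q·max 4 (2τψ) ≤ 1`, the AMPLITUDE rows `8ΦτY ≤ 1`, `128eψ³τ⁴Φκ_A·Y ≤ (1−r)ρ³`, and `λ ≤ λ₀`: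

* **`towerBorn_le_law_tracks_of_rows`** ⊢ `∀ k ≤ K, ∀ t, ∀ 3 ≤ p ≤ D, b t k p ≤ A·λ^{p−1}·Q^p` (with `b t 0 p = 0`).
Every model assembly is then: discharge the two row hypotheses from its own rows, `rfl` the eight binders, done.
Pure real analysis; nothing about the model is asserted; nothing asserts any stub, (ℓ), K3 or superconductivity.
References: Benfatto–Giuliani–Mastropietro 2006 §2.8 (2.83), (2.93)–(2.98) [cite: BenfattoGiulianiMastropietro2006]; Gawȩdzki–Kupiainen 1985 §3.
-/

noncomputable section

namespace Summit.HubbardSuperconductivity.HubbardSuperconductivity.Theorems.EngineV8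

set_option linter.dupNamespace false -- summit = problem name (single-conjunct summit), D-0017

open Real Finset

/-- **THE TRACK INDUCTION WITH ITS NUMERICS CLOSED** (see the module docstring: T3-P ∘ (I5)-LEV-G; the equational binders are the explicit choices, `rfl` at the call).
[cite: BenfattoGiulianiMastropietro2006, §2.8 (2.83), (2.93)-(2.98)] -/
theorem towerBorn_le_law_tracks_of_rows {T : Type*} {D K : ℕ} {b : T → ℕ → ℕ → ℝ} {μ : ℕ → ℕ → ℝ}
    {σ Φ ψ τ W Z κA κQ r Qb a₁ a₂ q₀ ι₁ ι₂ X lam ρ Q' Q a Y A A' ι₃ : ℝ}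
    (hσ : 0 ≤ σ) (hΦ : 0 ≤ Φ) (hψ : 0 ≤ ψ) (hτ : 0 < τ) (hW : 0 < W) (hZ : 0 < Z) (hκA : 0 < κA) (hκQ : 0 ≤ κQ) (hr1 : r < 1) (hQb : 0 ≤ Qb)
    (ha₁ : 0 < a₁) (ha₂ : 0 ≤ a₂) (hq₀ : 0 ≤ q₀) (hι₁ : 0 ≤ ι₁) (hι₂ : 0 ≤ ι₂) (hX : 0 ≤ X) (hlam : 0 < lam)
    -- the explicit (I5)-LEV-G choices
    (hρ : ρ = max 4 (2 * τ * ψ)) (hQ' : Q' = Z * Qb + q₀ + 1) (hQ : Q = ρ * Q') (ha : a = a₁ + κA * a₂)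
    (hY : Y = ι₂ / (2 * Q') + W * Z ^ 3 * X / (4 * Q' ^ 2) + a * Q' / 2) (hA : A = 2 * Y * (1 - r) / (κA * Q'))
    (hA' : A' = a + 2 * Y / Q') (hι₃ : ι₃ = W * Z ^ 3 * X + A' * Q' ^ 3)
    -- the BLOCKING row and the two AMPLITUDE rows
    (hblock : max 1 Z * κQ * max 4 (2 * τ * ψ) ≤ 1)
    (amp1 : 8 * Φ * τ * Y ≤ 1) (amp2 : 128 * exp 1 * ψ ^ 3 * τ ^ 4 * Φ * κA * Y ≤ (1 - r) * ρ ^ 3)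
    -- the arrays
    (hμ0 : ∀ k m, 0 ≤ μ k m) (h0 : ∀ t p, 3 ≤ p → p ≤ D → b t 0 p = 0)
    -- the base / UV block in its own constants
    (hbase : ∀ m, 3 ≤ m → m ≤ D → μ 0 m ≤ a₁ * lam ^ (m - 1) * q₀ ^ m)
    -- the `R`-rows of the blocks `k ≥ 1` in parametric shape (with the six-leg cell `X`)
    (hR : ∀ k, 1 ≤ k → k < K → (∀ k' ≤ k, ∀ t, ∀ p, 3 ≤ p → p ≤ D → b t k' p ≤ A * lam ^ (p - 1) * Q ^ p) →
      (∀ m, 4 ≤ m → m ≤ D → μ k m ≤ κA * (a₂ + A / (1 - r)) * lam ^ (m - 1) * (Z * κQ * max Q Qb) ^ m) ∧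
      (3 ≤ D → μ k 3 ≤ max (W * Z ^ 3 * X * lam ^ 2) (κA * (a₂ + A / (1 - r)) * lam ^ 2 * (Z * κQ * max Q Qb) ^ 3)))
    -- the imports and the step (kit literal)
    (hι₁' : ∀ k < K, μ k 1 ≤ ι₁ * lam) (hι₂' : ∀ k < K, μ k 2 ≤ ι₂ * lam)
    (hstep : ∀ t, ∀ k < K, ∀ N : ℕ, 2 ≤ N → ∀ p, 3 ≤ p → p ≤ D → Φ * towerV D τ (μ k) < 1 →
      b t (k + 1) p ≤ towerFO D σ (μ k) p + ∑ n ∈ Icc 2 N, exp 1 * Φ ^ (n - 1) * ψ ^ p * towerS D τ (μ k) n p +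
        ψ ^ p * exp 1 * towerV D τ (μ k) * (Φ * towerV D τ (μ k)) ^ N / (1 - Φ * towerV D τ (μ k)))
    -- the coupling smallness
    (hle : lam ≤ min 1 (min (1 / (8 * σ * Q' + 1)) (min (1 / (2 * exp 1 * τ * Q' + 1)) (min (1 / (4 * Φ * τ * ι₁ + 1))
      (min (1 / (2 * (Φ * (exp 1 * τ * ι₁ + (exp 1 * τ) ^ 2 * ι₂ + (exp 1 * τ) ^ 3 * ι₃ + A' * (exp 1 * τ * Q') ^ 2 / 2)) + 1))
        (min (A * Q ^ 3 / (16 * σ * Q' * A' * (4 * Q') ^ 3 + A * Q ^ 3))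
          (A * Q ^ 3 / (16 * exp 1 * ψ * (2 * τ * ψ * Q') ^ 2 * Φ * τ ^ 2 * ι₁ ^ 2 + A * Q ^ 3)))))))) :
    ∀ k ≤ K, ∀ t, ∀ p, 3 ≤ p → p ≤ D → b t k p ≤ A * lam ^ (p - 1) * Q ^ p := by
  obtain ⟨⟨hQ'0, hQ0, hA0, hA'0, hι₃0, hAQ⟩, ⟨hF1, hF2, hF3, hF4, hFq, hF6, hF7⟩, ⟨hu₁, hu₂⟩, N1, N2⟩ :=
    towerLevNumericsG_rows hW hZ hκA hκQ hr1 hQb ha₁ ha₂ hq₀ hι₂ hX hρ hQ' hQ ha hY hA hA' hι₃ hblock amp1 amp2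
  obtain ⟨hx₁, hx₂, hx₃, hy, hθ, hclose⟩ := towerLevNumericsG_side_of_lam_le hσ hΦ hψ hτ hW hZ hκA hκQ hr1 hQb ha₁ ha₂ hq₀ hι₁ hι₂ hX hρ hQ' hQ ha hY
    hA hA' hι₃ hblock amp1 amp2 hlam.le hle
  have hr : 0 < 1 - r := sub_pos.2 hr1
  -- domination of the parametric profile constants by `(A′, Q′)`
  have hAR0 : 0 ≤ κA * (a₂ + A / (1 - r)) := by
    have : 0 ≤ A / (1 - r) := div_nonneg hA0.le hr.le
    positivity
  have hQR0 : 0 ≤ Z * κQ * max Q Qb := by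
    have : 0 ≤ max Q Qb := le_max_of_le_left hQ0.le
    positivity
  have hdom : ∀ m : ℕ, κA * (a₂ + A / (1 - r)) * lam ^ (m - 1) * (Z * κQ * max Q Qb) ^ m ≤ A' * lam ^ (m - 1) * Q' ^ m := fun m =>
    mul_le_mul (mul_le_mul_of_nonneg_right hF2 (pow_nonneg hlam.le _)) (pow_le_pow_left₀ hQR0 hF4 m) (pow_nonneg hQR0 _) (by positivity)
  have hdom0 : ∀ m : ℕ, a₁ * lam ^ (m - 1) * q₀ ^ m ≤ A' * lam ^ (m - 1) * Q' ^ m := fun m =>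
    mul_le_mul (mul_le_mul_of_nonneg_right hF1 (pow_nonneg hlam.le _)) (pow_le_pow_left₀ hq₀ hFq m) (pow_nonneg hq₀ _) (by positivity)
  refine towerBorn_le_law_tracks_of_profile (T := T) (K := K) (D := D) (b := b) (μ := μ) (A := A) (lam := lam) (Q := Q) (A' := A') (Q' := Q')
    (ι₃ := ι₃) hlam hQ0.le hσ hΦ hψ hτ hQ'0 hA'0 hμ0 ?_ ?_ ?_ hι₁' hι₂' hstep hx₁ hx₂ hx₃ hy hθ hu₁ hu₂ hclose
  · -- `h0`: the born array vanishes at block `0`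
    intro t p hp hpD
    rw [h0 t p hp hpD]
    positivity
  · -- `hprof`
    intro k hk ih m hm hmD
    rcases Nat.eq_zero_or_pos k with rfl | hk1
    · exact (hbase m (by omega) hmD).trans (hdom0 m)
    · exact ((hR k hk1 hk ih).1 m hm hmD).trans (hdom m)
  · -- `hprof3`
    intro k hk hD3 ih
    rcases Nat.eq_zero_or_pos k with rfl | hk1
    · calc μ 0 3 ≤ a₁ * lam ^ (3 - 1) * q₀ ^ 3 := hbase 3 le_rfl hD3
        _ ≤ A' * lam ^ (3 - 1) * Q' ^ 3 := hdom0 3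
        _ = A' * Q' ^ 3 * lam ^ 2 := by ring
        _ ≤ ι₃ * lam ^ 2 := mul_le_mul_of_nonneg_right hF7 (sq_nonneg _)
    · refine ((hR k hk1 hk ih).2 hD3).trans (max_le ?_ ?_)
      · exact mul_le_mul_of_nonneg_right hF6 (sq_nonneg _)
      · calc κA * (a₂ + A / (1 - r)) * lam ^ 2 * (Z * κQ * max Q Qb) ^ 3
            = κA * (a₂ + A / (1 - r)) * lam ^ (3 - 1) * (Z * κQ * max Q Qb) ^ 3 := by norm_num
          _ ≤ A' * lam ^ (3 - 1) * Q' ^ 3 := hdom 3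
          _ = A' * Q' ^ 3 * lam ^ 2 := by ring
          _ ≤ ι₃ * lam ^ 2 := mul_le_mul_of_nonneg_right hF7 (sq_nonneg _)

end Summit.HubbardSuperconductivity.HubbardSuperconductivity.Theorems.EngineV8

end
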